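import Mathlib
import HarnessLib
import Summits.AtomisticToContinuum.FouriersLaw.Theses.HoelderEscapeProfile
import Literature.MathematicalPhysics.KineticTheory.InfiniteChainShiftInvariantUniqueness
import Literature.MathematicalPhysics.KineticTheory.InfiniteChainEnergyDensityMoments
import Literature.MathematicalPhysics.KineticTheory.InfiniteChainGibbsMomentaIndependence
import Literature.MathematicalPhysics.KineticTheory.InfiniteChainGibbsBondForceByParts
import Literature.MathematicalPhysics.KineticTheory.InfiniteChainCurrentPositiveType
import Literature.MathematicalPhysics.KineticTheory.InfiniteChainPartialMomentumReversal
import Literature.Probability.Distributions.GaussianMoments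
import Summits.AtomisticToContinuum.FouriersLaw.Theorems.EmbeddedDrudeMourreDrudeDissolutionStubHarmonicSteinMomentum

/-!
# Stub `stub_staticRiesz` of line `Sketch` (crux `HoelderEscapeProfile.LocalEnergyHalfHoelder`,
# item stmt-AtomisticToContinuum-16008): the static Riesz constant `χ_min = T²/2`

Support file (closes nothing; `--supports stmt-AtomisticToContinuum-16008`).  For the guarded pair
`(μ, D)` of the pinned anharmonic chain at temperature `T` (a shift-invariant DLR state `μ` and a
`μ`-preserving dynamics `D`), the split-bond site energy `h_x = ½p_x² + U(q_x) + ½[V(q_{x+1}-q_x) +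
V(q_x-q_{x-1})]` and the pulse `S(x,t) = Cov_μ(h_0, h_x ∘ φ_t)`:

  `(T²/2) Σ_{|x|≤L} a_x² ≤ Σ_x Σ_y a_x a_y S(y-x, 0)`  for every window `L` and coefficients `a`.

Proof.  `S(y-x,0) = Cov(h_x,h_y)` (`φ_0 = id` a.e., shift invariance), so the right side is
`Var(F)`, `F = Σ a_x h_x`.  Write `F - E F = A + B` with `A = Σ_x (a_x/2)(p_x² - T)` and `B` a
function of the positions only.  Under any DLR state each `p_x` is `N(0,T)` and independent of
everything else (`indepFun_update_snd`, from `IsChainGibbsMeasure.lintegral_snd_mul`), hence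
`E[(p_x²-T) G] = 0` for every observable `G` not reading `p_x`: the cross terms `E[AB]` and
`E[(p_x²-T)(p_y²-T)]` (`x ≠ y`) vanish and `E[(p_x²-T)²] = E p⁴ - T² = 2T²`.  Therefore
`Var F = E A² + 2E[AB] + E B² ≥ E A² = (T²/2) Σ a_x²`.  Square integrability of `h_x` comes from
superstability of the shift-invariant DLR state (`hasSuperstabilityEstimate_of_isShiftInvariant_pinnedChain`,
`memLp_energyDensityZ_pinnedChain`).  No definitions, no named facts, no sorry.
-/

noncomputable section

open MeasureTheory ProbabilityTheory Filter Set Function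
open Literature.MathematicalPhysics.KineticTheory
open Literature.MathematicalPhysics.KineticTheory.HeatConduction
open Literature.MathematicalPhysics.KineticTheory.HeatConduction.OscillatorChain
open scoped NNReal ENNReal

namespace Summit.AtomisticToContinuum.FouriersLaw.Theorems.LocalEnergyHalfHoelder.NashDoubling

/-- **`p_x² - T` is orthogonal to every observable not reading `p_x`.**  For a nearest-neighbour
chain with continuous `U, V`, `T > 0`, a DLR state `μ` at `T`, a site `x` and a measurable
observable `G` with `G(σ[p_x ↦ p]) = G(σ)`: `∫ G · (p_x² - T) dμ = 0` (independence of `p_x` from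
`σ[p_x ↦ 0]` and `E p_x² = T`). [cite: LanfordLebowitzLieb1977, §4 remark (ii)] -/
theorem integral_mul_sq_snd_sub_eq_zero {P : OscillatorChain} (hU : Continuous P.U)
    (hV : Continuous P.V) {T : ℝ} (hT : 0 < T) {μ : Measure ChainConfig}
    (hμ : P.IsChainGibbsMeasure T μ) (x : ℤ) {G : ChainConfig → ℝ} (hG : Measurable G)
    (hGi : ∀ (σ : ChainConfig) (p : ℝ), G (Function.update σ x ((σ x).1, p)) = G σ) :
    ∫ σ, G σ * ((σ x).2 ^ 2 - T) ∂μ = 0 := by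
  haveI : IsProbabilityMeasure μ := hμ.isProbabilityMeasure
  have hX : Measurable fun σ : ChainConfig => (σ x).2 := (measurable_pi_apply x).snd
  have hY : Measurable fun σ : ChainConfig => Function.update σ x ((σ x).1, 0) :=
    DrudeDissolution.GramPencilHarmonicChaos.measurable_update_snd_zero x
  have hf : Measurable fun p : ℝ => p ^ 2 - T := (measurable_id.pow_const 2).sub_const T
  have key := (DrudeDissolution.GramPencilHarmonicChaos.indepFun_update_snd hU hV hT hμ x)
    |>.integral_fun_comp_mul_comp (f := G) (g := fun p : ℝ => p ^ 2 - T)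
      hY.aemeasurable hX.aemeasurable hG.aestronglyMeasurable hf.aestronglyMeasurable
  have hGi0 : ∀ σ : ChainConfig, G (Function.update σ x ((σ x).1, 0)) = G σ := fun σ => hGi σ 0
  simp only [hGi0] at key
  rw [key]
  have hsq : Measurable fun p : ℝ => p ^ 2 := measurable_id.pow_const 2
  have hp2 : ∫ σ, (σ x).2 ^ 2 ∂μ = T := by
    rw [← integral_map (φ := fun σ : ChainConfig => (σ x).2) hX.aemeasurable
      hsq.aestronglyMeasurable, hμ.map_snd hU hV hT x, integral_sq_gaussianReal hT.le]
  have hpi : Integrable (fun σ : ChainConfig => (σ x).2 ^ 2) μ := by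
    refine (integrable_map_measure hsq.aestronglyMeasurable hX.aemeasurable).1 ?_
    rw [hμ.map_snd hU hV hT x]
    exact Literature.Probability.Distributions.integrable_pow_gaussianReal 0 T.toNNReal 2
  rw [integral_sub hpi (integrable_const T), hp2]
  simp

/-- **`p_x²` is square integrable** under a DLR state at `T > 0` (its law is `N(0,T)`, all of
whose moments are finite). [folklore] -/
theorem memLp_two_snd_sq {P : OscillatorChain} (hU : Continuous P.U) (hV : Continuous P.V)
    {T : ℝ} (hT : 0 < T) {μ : Measure ChainConfig} (hμ : P.IsChainGibbsMeasure T μ) (x : ℤ) :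
    MemLp (fun σ : ChainConfig => (σ x).2 ^ 2) 2 μ := by
  have hX : Measurable fun σ : ChainConfig => (σ x).2 := (measurable_pi_apply x).snd
  have hsq : Measurable fun p : ℝ => p ^ 2 := measurable_id.pow_const 2
  have h : MemLp (fun p : ℝ => p ^ 2) 2 (μ.map fun σ : ChainConfig => (σ x).2) := by
    rw [hμ.map_snd hU hV hT x]
    refine (memLp_two_iff_integrable_sq hsq.aestronglyMeasurable).2 ?_
    have e : (fun p : ℝ => (p ^ 2) ^ 2) = fun p : ℝ => p ^ 4 := by
      funext p; ring
    rw [e]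
    exact Literature.Probability.Distributions.integrable_pow_gaussianReal 0 T.toNNReal 4
  exact h.comp_of_map hX.aemeasurable

/-- **`E[(p_x² - T)²] = 2T²`** under a DLR state at `T > 0` (`E p⁴ = 3T²`, `E p² = T` for
`p ∼ N(0,T)`). [folklore] -/
theorem integral_sq_snd_sub_sq {P : OscillatorChain} (hU : Continuous P.U) (hV : Continuous P.V)
    {T : ℝ} (hT : 0 < T) {μ : Measure ChainConfig} (hμ : P.IsChainGibbsMeasure T μ) (x : ℤ) :
    ∫ σ, ((σ x).2 ^ 2 - T) ^ 2 ∂μ = 2 * T ^ 2 := by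
  have hX : Measurable fun σ : ChainConfig => (σ x).2 := (measurable_pi_apply x).snd
  have hf : Measurable fun p : ℝ => (p ^ 2 - T) ^ 2 :=
    ((measurable_id.pow_const 2).sub_const T).pow_const 2
  rw [← integral_map (φ := fun σ : ChainConfig => (σ x).2) hX.aemeasurable hf.aestronglyMeasurable,
    hμ.map_snd hU hV hT x]
  have h4 := Literature.Probability.Distributions.integral_pow_even_gaussianReal T.toNNReal 2
  have h3 : Nat.doubleFactorial (2 * 2 - 1) = 3 := by decide
  rw [h3, show 2 * 2 = 4 from rfl, Real.coe_toNNReal T hT.le] at h4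
  have h2 := integral_sq_gaussianReal hT.le
  have i4 := Literature.Probability.Distributions.integrable_pow_gaussianReal 0 T.toNNReal 4
  have i2 := Literature.Probability.Distributions.integrable_pow_gaussianReal 0 T.toNNReal 2
  have i2' : Integrable (fun p : ℝ => 2 * T * p ^ 2) (gaussianReal 0 T.toNNReal) := i2.const_mul _
  have i42 : Integrable (fun p : ℝ => p ^ 4 - 2 * T * p ^ 2) (gaussianReal 0 T.toNNReal) :=
    i4.sub i2'
  have e : ∀ p : ℝ, (p ^ 2 - T) ^ 2 = p ^ 4 - 2 * T * p ^ 2 + T ^ 2 := fun p => by ring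
  simp_rw [e]
  rw [integral_add i42 (integrable_const _), integral_sub i4 i2', integral_const_mul, h4, h2]
  simp only [integral_const, smul_eq_mul, probReal_univ, one_mul, Nat.cast_ofNat]
  ring

/-- **The static Riesz constant `χ_min = T²/2`** (stub `stub_staticRiesz`, signature spelled out).
For the guarded pair `(μ, D)` of the pinned anharmonic chain at temperature `T`, the split-bond site
energy `h` and the pulse `S(x,t) = Cov_μ(h_0, h_x ∘ φ_t)`: for every window `L` and coefficient
vector `a`, `(T²/2) Σ_{|x|≤L} a_x² ≤ Σ_x Σ_y a_x a_y S(y-x,0) (= Var_μ(Σ a_x h_x))`.  The momenta are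
`N(0,T)`, independent of everything else, so `Var(Σ a_x h_x) ≥ Var(Σ a_x p_x²/2) = (T²/2) Σ a_x²`.
[cite: LanfordLebowitzLieb1977, §4 remark (ii)] -/
theorem staticRiesz : ∀ ω₂ lam β γ : ℝ, 0 < ω₂ → 0 < lam → 0 < β → ∀ T : ℝ, 0 < T → ∀ μ : MeasureTheory.Measure Literature.MathematicalPhysics.KineticTheory.HeatConduction.ChainConfig, (Literature.MathematicalPhysics.KineticTheory.HeatConduction.pinnedChain ω₂ lam β γ).IsChainGibbsMeasure T μ → Literature.MathematicalPhysics.KineticTheory.HeatConduction.IsShiftInvariant μ → μ.map (fun σ : Literature.MathematicalPhysics.KineticTheory.HeatConduction.ChainConfig => fun x : ℤ => ((σ x).1, -(σ x).2)) = μ → ∀ D : Literature.MathematicalPhysics.KineticTheory.HeatConduction.InfiniteChainDynamics (Literature.MathematicalPhysics.KineticTheory.HeatConduction.pinnedChain ω₂ lam β γ), D.PreservesMeasure μ → (∀ t : ℝ, ∀ᵐ σ ∂μ, D.flow t (Literature.MathematicalPhysics.KineticTheory.HeatConduction.shift σ) = Literature.MathematicalPhysics.KineticTheory.HeatConduction.shift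 (D.flow t σ)) → ∀ h : Literature.MathematicalPhysics.KineticTheory.HeatConduction.ChainConfig → ℤ → ℝ, h = (fun (σ : Literature.MathematicalPhysics.KineticTheory.HeatConduction.ChainConfig) (x : ℤ) => (σ x).2 ^ 2 / 2 + (Literature.MathematicalPhysics.KineticTheory.HeatConduction.pinnedChain ω₂ lam β γ).U (σ x).1 + ((Literature.MathematicalPhysics.KineticTheory.HeatConduction.pinnedChain ω₂ lam β γ).V ((σ (x + 1)).1 - (σ x).1) + (Literature.MathematicalPhysics.KineticTheory.HeatConduction.pinnedChain ω₂ lam β γ).V ((σ x).1 - (σ (x - 1)).1)) / 2) → ∀ S : ℤ → ℝ → ℝ, S = (fun (x : ℤ) (t : ℝ) => ∫ σ, (h σ 0 - ∫ σ', h σ' 0 ∂μ) * (h (D.flow t σ) x - ∫ σ', h σ' 0 ∂μ) ∂μ) → (∀ ν : ℝ, 0 < ν → MeasureTheory.IntegrableOn (fun t : ℝ => Real.exp (-(ν * t)) * S 0 t) (Set.Ioi 0)) → ∀ (L : ℕ) (a : ℤ → ℝ), T ^ 2 / 2 * ∑ x ∈ Finset.Icc (-(L:ℤ)) (L:ℤ),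 a x ^ 2 ≤ ∑ x ∈ Finset.Icc (-(L:ℤ)) (L:ℤ), ∑ y ∈ Finset.Icc (-(L:ℤ)) (L:ℤ), a x * a y * S (y - x) 0 := by
  intro ω₂ lam β γ hω hl hβ T hT μ hG hSI _hRefl D hP _hShift h hh S hS _hInt L a
  haveI : IsProbabilityMeasure μ := hG.isProbabilityMeasure
  have hU : Continuous (pinnedChain ω₂ lam β γ).U := continuous_pinnedChain_U ω₂ lam β γ
  have hV : Continuous (pinnedChain ω₂ lam β γ).V := continuous_pinnedChain_V ω₂ lam β γ
  have hss : (pinnedChain ω₂ lam β γ).HasSuperstabilityEstimate μ :=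
    hasSuperstabilityEstimate_of_isShiftInvariant_pinnedChain γ hω hl.le hβ.le hT hG hSI
  -- `h` is the energy density `energyDensityZ`
  have hZ : ∀ (σ : ChainConfig) (z : ℤ), h σ z = (pinnedChain ω₂ lam β γ).energyDensityZ σ z := by
    intro σ z; subst hh; rfl
  have hfun : ∀ z : ℤ, (fun σ : ChainConfig => h σ z) =
      fun σ => (pinnedChain ω₂ lam β γ).energyDensityZ σ z := fun z => funext fun σ => hZ σ z
  have hmh : ∀ z : ℤ, Measurable fun σ : ChainConfig => h σ z := by
    intro z
    rw [hfun z]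
    exact (pinnedChain ω₂ lam β γ).measurable_energyDensityZ hU.measurable hV.measurable z
  have hL2h : ∀ z : ℤ, MemLp (fun σ : ChainConfig => h σ z) 2 μ := by
    intro z
    rw [hfun z]
    exact memLp_energyDensityZ_pinnedChain γ hω.le hl.le hβ.le hss z (by norm_num)
  set m : ℝ := ∫ σ', h σ' 0 ∂μ with hm
  set W : Finset ℤ := Finset.Icc (-(L:ℤ)) (L:ℤ) with hW
  have hc2 : ∀ z : ℤ, MemLp (fun σ : ChainConfig => h σ z - m) 2 μ :=
    fun z => (hL2h z).sub (memLp_const m)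
  -- Steps 1–2: `S(y-x, 0) = ∫ (h_x - m)(h_y - m) dμ` (`φ_0 = id` a.e., shift invariance)
  have hS0 : ∀ x y : ℤ, S (y - x) 0 = ∫ σ, (h σ x - m) * (h σ y - m) ∂μ := by
    intro x y
    have hmeas : Measurable fun σ : ChainConfig => (h σ 0 - m) * (h σ (y - x) - m) :=
      ((hmh 0).sub_const m).mul ((hmh (y - x)).sub_const m)
    rw [hS]
    dsimp only
    calc ∫ σ, (h σ 0 - m) * (h (D.flow 0 σ) (y - x) - m) ∂μ
        = ∫ σ, (h σ 0 - m) * (h σ (y - x) - m) ∂μ := by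
          refine integral_congr_ae ?_
          filter_upwards [D.flow_zero_ae_eq hP] with σ hσ
          rw [hσ]
      _ = ∫ σ, (fun σ : ChainConfig => (h σ 0 - m) * (h σ (y - x) - m)) (chainShift x σ) ∂μ :=
          (integral_comp_eq_of_measurePreserving (hSI.measurePreserving_chainShift x) hmeas).symm
      _ = ∫ σ, (h σ x - m) * (h σ y - m) ∂μ := by
          simp only [hZ, energyDensityZ_chainShift, zero_add, sub_add_cancel]
  -- Step 3: the right side is `∫ F² dμ`, `F = Σ a_x (h_x - m)`
  have hI : ∀ x y : ℤ, Integrable (fun σ : ChainConfig => a x * a y * ((h σ x - m) * (h σ y - m))) μ :=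
    fun x y => ((hc2 x).integrable_mul (hc2 y)).const_mul (a x * a y)
  have hRHS : ∑ x ∈ W, ∑ y ∈ W, a x * a y * S (y - x) 0 =
      ∫ σ, (∑ x ∈ W, a x * (h σ x - m)) ^ 2 ∂μ := by
    have step1 : ∀ x : ℤ, ∑ y ∈ W, a x * a y * S (y - x) 0 =
        ∫ σ, ∑ y ∈ W, a x * a y * ((h σ x - m) * (h σ y - m)) ∂μ := by
      intro x
      rw [integral_finsetSum W (fun y _ => hI x y)]
      refine Finset.sum_congr rfl fun y _ => ?_
      rw [hS0, integral_const_mul]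
    rw [Finset.sum_congr rfl (fun x _ => step1 x),
      ← integral_finsetSum W (fun x _ => integrable_finsetSum W (fun y _ => hI x y))]
    refine integral_congr_ae (Eventually.of_forall fun σ => ?_)
    simp only
    rw [sq, Finset.sum_mul_sum]
    exact Finset.sum_congr rfl fun x _ => Finset.sum_congr rfl fun y _ => by ring
  -- Step 4: `F = A + B`, `A = Σ (a_x/2)(p_x² - T)`, `B` a function of the positions
  set c : ℤ → ChainConfig → ℝ := fun x σ => (σ x).2 ^ 2 - T with hcdef
  set A : ChainConfig → ℝ := fun σ => ∑ x ∈ W, a x / 2 * c x σ with hAdef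
  set gB : (ℤ → ℝ) → ℝ := fun q => ∑ x ∈ W,
    a x * ((pinnedChain ω₂ lam β γ).U (q x) + ((pinnedChain ω₂ lam β γ).V (q (x + 1) - q x) +
      (pinnedChain ω₂ lam β γ).V (q x - q (x - 1))) / 2 + T / 2 - m) with hgBdef
  set B : ChainConfig → ℝ := fun σ => gB (fun z => (σ z).1) with hBdef
  have hsplit : ∀ σ : ChainConfig, ∑ x ∈ W, a x * (h σ x - m) = A σ + B σ := by
    intro σ
    simp only [hAdef, hBdef, hgBdef, hcdef, hZ, OscillatorChain.energyDensityZ]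
    rw [← Finset.sum_add_distrib]
    exact Finset.sum_congr rfl fun x _ => by ring
  -- measurability and square integrability
  have hq : ∀ z : ℤ, Measurable fun q : ℤ → ℝ => q z := fun z => measurable_pi_apply z
  have hgBm : Measurable gB := by
    refine Finset.measurable_sum W fun x _ => ?_
    exact ((((hU.measurable.comp (hq x)).add (((hV.measurable.comp ((hq (x + 1)).sub (hq x))).add
      (hV.measurable.comp ((hq x).sub (hq (x - 1))))).div_const 2)).add_const (T / 2)).sub_const m).const_mul (a x)
  have hBm : Measurable B := hgBm.comp measurable_positionField
  have hBi : ∀ (x : ℤ) (σ : ChainConfig) (p : ℝ), B (Function.update σ x ((σ x).1, p)) = B σ := by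
    intro x σ p
    show gB (fun z => (Function.update σ x ((σ x).1, p) z).1) = gB (fun z => (σ z).1)
    rw [positionField_update_snd]
  have hcm : ∀ x : ℤ, Measurable (c x) := fun x =>
    ((measurable_pi_apply x).snd.pow_const 2).sub_const T
  have hcL2 : ∀ x : ℤ, MemLp (c x) 2 μ := fun x =>
    (memLp_two_snd_sq hU hV hT hG x).sub (memLp_const T)
  have hAL2 : MemLp A 2 μ := memLp_finsetSum W (fun x _ => (hcL2 x).const_mul (a x / 2))
  have hFL2 : MemLp (fun σ : ChainConfig => ∑ x ∈ W, a x * (h σ x - m)) 2 μ :=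
    memLp_finsetSum W (fun x _ => (hc2 x).const_mul (a x))
  have hBL2 : MemLp B 2 μ := by
    refine (hFL2.sub hAL2).ae_eq (Eventually.of_forall fun σ => ?_)
    simp only [Pi.sub_apply]
    rw [hsplit σ]
    ring
  -- the Gaussian computations
  have hcB : ∀ x : ℤ, ∫ σ, B σ * c x σ ∂μ = 0 := fun x =>
    integral_mul_sq_snd_sub_eq_zero hU hV hT hG x hBm (hBi x)
  have hcc : ∀ x y : ℤ, y ≠ x → ∫ σ, c y σ * c x σ ∂μ = 0 := by
    intro x y hyx
    refine integral_mul_sq_snd_sub_eq_zero hU hV hT hG x (hcm y) fun σ p => ?_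
    simp only [hcdef, Function.update_of_ne hyx]
  have hcx : ∀ x : ℤ, ∫ σ, c x σ * c x σ ∂μ = 2 * T ^ 2 := by
    intro x
    rw [← integral_sq_snd_sub_sq hU hV hT hG x]
    exact integral_congr_ae (Eventually.of_forall fun σ => by simp only [hcdef]; ring)
  have hAB : ∫ σ, A σ * B σ ∂μ = 0 := by
    have e : ∀ σ : ChainConfig, A σ * B σ = ∑ x ∈ W, a x / 2 * (B σ * c x σ) := by
      intro σ
      simp only [hAdef]
      rw [Finset.sum_mul]
      exact Finset.sum_congr rfl fun x _ => by ring
    simp_rw [e]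
    have hIb : ∀ x : ℤ, Integrable (fun σ : ChainConfig => a x / 2 * (B σ * c x σ)) μ :=
      fun x => ((hBL2.integrable_mul (hcL2 x)).const_mul (a x / 2))
    rw [integral_finsetSum W (fun x _ => hIb x)]
    refine Finset.sum_eq_zero fun x _ => ?_
    rw [integral_const_mul, hcB x, mul_zero]
  have hAA : ∫ σ, A σ * A σ ∂μ = T ^ 2 / 2 * ∑ x ∈ W, a x ^ 2 := by
    have e : ∀ σ : ChainConfig, A σ * A σ =
        ∑ x ∈ W, ∑ y ∈ W, a x / 2 * (a y / 2) * (c y σ * c x σ) := by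
      intro σ
      simp only [hAdef]
      rw [Finset.sum_mul_sum]
      exact Finset.sum_congr rfl fun x _ => Finset.sum_congr rfl fun y _ => by ring
    simp_rw [e]
    have hIc : ∀ x y : ℤ, Integrable (fun σ : ChainConfig => a x / 2 * (a y / 2) * (c y σ * c x σ)) μ :=
      fun x y => ((hcL2 y).integrable_mul (hcL2 x)).const_mul _
    rw [integral_finsetSum W (fun x _ => integrable_finsetSum W (fun y _ => hIc x y))]
    have inner : ∀ x ∈ W, ∫ σ, ∑ y ∈ W, a x / 2 * (a y / 2) * (c y σ * c x σ) ∂μ =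
        T ^ 2 / 2 * a x ^ 2 := by
      intro x hx
      rw [integral_finsetSum W (fun y _ => hIc x y),
        Finset.sum_eq_single_of_mem x hx (fun y _ hyx => by
          rw [integral_const_mul, hcc x y hyx, mul_zero]),
        integral_const_mul, hcx x]
      ring
    rw [Finset.sum_congr rfl inner, ← Finset.mul_sum]
  -- assemble: `∫ F² ≥ ∫ (A² + 2AB) = (T²/2) Σ a_x²`
  rw [hRHS]
  have hIAA : Integrable (fun σ : ChainConfig => A σ * A σ) μ := hAL2.integrable_mul hAL2
  have hIAB : Integrable (fun σ : ChainConfig => 2 * (A σ * B σ)) μ :=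
    (hAL2.integrable_mul hBL2).const_mul 2
  have hlow : Integrable (fun σ : ChainConfig => A σ * A σ + 2 * (A σ * B σ)) μ := hIAA.add hIAB
  calc T ^ 2 / 2 * ∑ x ∈ W, a x ^ 2 = ∫ σ, (A σ * A σ + 2 * (A σ * B σ)) ∂μ := by
        rw [integral_add hIAA hIAB, integral_const_mul, hAA, hAB]
        ring
    _ ≤ ∫ σ, (∑ x ∈ W, a x * (h σ x - m)) ^ 2 ∂μ := by
        refine integral_mono hlow hFL2.integrable_sq fun σ => ?_
        simp only
        rw [hsplit σ]
        nlinarith [sq_nonneg (B σ)]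

/-- **Statement of the registered stub `stub_staticRiesz`** (verbatim copy of `Stmt.stub_staticRiesz`
of the skeleton `Cruxes/LocalEnergyHalfHoelder/Lines/Sketch.lean`, in this file's namespace so the
skeleton can import it without a clash): uniform strict positive-definiteness of the energy
covariance of the guarded state, `(T²/2) Σ_{|x|≤L} a_x² ≤ Σ_x Σ_y a_x a_y S(y-x, 0)`. -/
abbrev Stmt.stub_staticRiesz : Prop :=
    ∀ ω₂ lam β γ : ℝ, 0 < ω₂ → 0 < lam → 0 < β → ∀ T : ℝ, 0 < T → ∀ μ : MeasureTheory.Measure Literature.MathematicalPhysics.KineticTheory.HeatConduction.ChainConfig, (Literature.MathematicalPhysics.KineticTheory.HeatConduction.pinnedChain ω₂ lam β γ).IsChainGibbsMeasure T μ → Literature.MathematicalPhysics.KineticTheory.HeatConduction.IsShiftInvariant μ → μ.map (fun σ : Literature.MathematicalPhysics.KineticTheory.HeatConduction.ChainConfig => fun x : ℤ => ((σ x).1, -(σ x).2)) = μ → ∀ D : Literature.MathematicalPhysics.KineticTheory.HeatConduction.InfiniteChainDynamics (Literature.MathematicalPhysics.KineticTheory.HeatConduction.pinnedChain ω₂ lam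 β γ), D.PreservesMeasure μ → (∀ t : ℝ, ∀ᵐ σ ∂μ, D.flow t (Literature.MathematicalPhysics.KineticTheory.HeatConduction.shift σ) = Literature.MathematicalPhysics.KineticTheory.HeatConduction.shift (D.flow t σ)) → ∀ h : Literature.MathematicalPhysics.KineticTheory.HeatConduction.ChainConfig → ℤ → ℝ, h = (fun (σ : Literature.MathematicalPhysics.KineticTheory.HeatConduction.ChainConfig) (x : ℤ) => (σ x).2 ^ 2 / 2 + (Literature.MathematicalPhysics.KineticTheory.HeatConduction.pinnedChain ω₂ lam β γ).U (σ x).1 + ((Literature.MathematicalPhysics.KineticTheory.HeatConduction.pinnedChain ω₂ lam β γ).V ((σ (x + 1)).1 - (σ x).1) + (Literature.MathematicalPhysics.KineticTheory.HeatConduction.pinnedChain ω₂ lam β γ).V ((σ x).1 - (σ (x - 1)).1)) / 2) → ∀ S : ℤ → ℝ → ℝ, S = (fun (x : ℤ) (t : ℝ) => ∫ σ, (h σ 0 - ∫ σ', h σ' 0 ∂μ) * (h (D.flow t σ) x - ∫ σ', h σ' 0 ∂μ) ∂μ) → (∀ ν : ℝ, 0 < ν → MeasureTheory.IntegrableOn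 (fun t : ℝ => Real.exp (-(ν * t)) * S 0 t) (Set.Ioi 0)) → ∀ (L : ℕ) (a : ℤ → ℝ), T ^ 2 / 2 * ∑ x ∈ Finset.Icc (-(L:ℤ)) (L:ℤ), a x ^ 2 ≤ ∑ x ∈ Finset.Icc (-(L:ℤ)) (L:ℤ), ∑ y ∈ Finset.Icc (-(L:ℤ)) (L:ℤ), a x * a y * S (y - x) 0

/-- **Registered stub `stub_staticRiesz`** (type `Stmt.stub_staticRiesz`, verbatim the skeleton's):
the static Riesz constant of the guarded pinned chain is `χ_min = T²/2` (`staticRiesz`).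
[cite: LanfordLebowitzLieb1977, §4 remark (ii)] -/
theorem stub_staticRiesz : Stmt.stub_staticRiesz :=
  staticRiesz

end Summit.AtomisticToContinuum.FouriersLaw.Theorems.LocalEnergyHalfHoelder.NashDoubling

end
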